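import Literature.NumberTheory.NumberFields.CMFieldCapitulationKernel
import Literature.NumberTheory.NumberFields.ClassGroupNormSurjective
import Literature.NumberTheory.NumberFields.ClassGroupPrimesAvoiding
import Mathlib.NumberTheory.NumberField.Cyclotomic.Basic
import HarnessLib

/-!
# `Cl(ℚ(ζ_{pⁿ})⁺) → Cl(ℚ(ζ_{pⁿ}))` is injective (`p` odd)
# (Washington, *Introduction to Cyclotomic Fields*, Thm. 4.14; Lang, *Cyclotomic Fields I–II*, Ch. 3 §4 Thm. 4.2)

Topic `NumberTheory/NumberFields`; namespace `Literature.NumberTheory.NumberFields`.  Theorem-only file (no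
definition, no named fact, no `sorry`), unconditional; sequel of `CMFieldCapitulationKernel.lean`
(Washington Thm. 10.3: `|ker(Cl_{K⁺} → Cl_K)| ≤ 2` for every CM field, via `u = ᾱ/α ∈ torsion K`).

> Washington, Thm. 4.14: "Let `K = ℚ(ζ_n)` [here `n = pᵐ`, `p` odd].  Then the natural map `C_{K⁺} → C_K`
> is an injection."  Lang, Ch. 3 §4, Thm. 4.2 (prime-power cyclotomic fields): "the natural map of ideal
> classes `C_{K⁺} → C_K` is injective."  Proof (Washington): if `𝔞𝓞_K = (α)` then `ᾱ/α` is a root of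
> unity `±ζ^r`; choosing `𝔞` prime to `p`, `α` is prime to `λ = 1 − ζ`, and `ᾱ ≡ α (mod λ)` since complex
> conjugation acts trivially on `𝓞_K/λ = 𝔽_p`; so `ᾱ/α ≡ 1 (mod λ)`, which excludes `−ζ^r ≡ −1` as
> `λ ∤ 2`; and `ζ^r = w/w̄` for `w = ζ^{r/2}` (`p` odd), so `αw` is conjugation-fixed and generates `𝔞`: `𝔞` is principal.

## Main results (`p` an odd prime, `K` a `{p^(k+1)}`-cyclotomic extension of `ℚ`, `K⁺ = maximalRealSubfield K`)

* `conj_sub_self_mem_span_toInteger_sub_one` — `x̄ ≡ x (mod ζ − 1)` on `𝓞 K`.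
* `exists_mk0_eq_and_not_dvd` — every ideal class of a Dedekind domain has a representative prime to a
  given finite set of primes (from the tree's `ClassGroupPrimesAvoiding.lean`).
* **`classGroupExtend_injective_of_isCyclotomicExtension_prime_pow`** — Washington Thm. 4.14 / Lang
  Thm. 4.2: `Cl(K⁺) → Cl(K)` is injective; with `ClassGroupNormSurjective.lean` (the norm is onto) this
  gives Lang's exact sequence `1 → C_K⁻ → C_K → C_{K⁺} → 1` for `K = ℚ(ζ_{p^{k+1}})`
  (`IsCMField.classGroupNorm_eq_one_iff_of_injective` in `CMFieldClassGroupNormConj.lean`).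

## References

* L. C. Washington, *Introduction to Cyclotomic Fields*, 2nd ed., GTM 83 (1997), Thm. 4.14, Thm. 10.3. [Washington1997]
* S. Lang, *Cyclotomic Fields I and II*, GTM 121 (1990), Ch. 3 §4, Thm. 4.2, Thm. 4.4. [Lang1990]
-/

noncomputable section

open NumberField NumberField.IsCMField NumberField.Units IsDedekindDomain
open scoped nonZeroDivisors

namespace Literature.NumberTheory.NumberFields

/-! ### §1. Every ideal class has a representative prime to a finite set of primes -/

/-- **Every ideal class contains an (integral) ideal prime to any given finite set of primes** (Neukirch
VI §1; Chinese remainder theorem — the tree's `ClassGroup.exists_mul_eq_span_and_forall_not_mem` moves one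
prime at a time). [cite: NeukirchANT1999, Ch. VI §1 (every class of `J^𝔪/P^𝔪` contains an integral ideal prime to `𝔪`)] -/
theorem exists_mk0_eq_and_not_dvd {R : Type*} [CommRing R] [IsDedekindDomain R]
    (S : Finset (HeightOneSpectrum R)) (c : ClassGroup R) :
    ∃ (I : Ideal R) (hI : I ≠ ⊥), ClassGroup.mk0 ⟨I, mem_nonZeroDivisors_iff_ne_zero.mpr hI⟩ = c ∧
      ∀ w ∈ S, ¬ w.asIdeal ∣ I := by
  classical
  -- write `c⁻¹ = [J]` and induct on the factorisation of `J`
  obtain ⟨⟨J, hJ⟩, hJc⟩ := ClassGroup.mk0_surjective c⁻¹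
  have hJ0 : J ≠ ⊥ := mem_nonZeroDivisors_iff_ne_zero.mp hJ
  have key : ∀ (J : Ideal R) (hJ0 : J ≠ ⊥), ∃ (I : Ideal R) (hI : I ≠ ⊥),
      ClassGroup.mk0 ⟨I, mem_nonZeroDivisors_iff_ne_zero.mpr hI⟩ *
        ClassGroup.mk0 ⟨J, mem_nonZeroDivisors_iff_ne_zero.mpr hJ0⟩ = 1 ∧
      ∀ w ∈ S, ¬ w.asIdeal ∣ I := by
    intro J
    refine UniqueFactorizationMonoid.induction_on_prime J ?_ ?_ ?_
    · intro h; exact absurd rfl h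
    · intro u hu _
      refine ⟨⊤, top_ne_bot, ?_, fun w _ hw => w.isPrime.ne_top (le_top.antisymm' (Ideal.le_of_dvd hw) ▸ rfl)⟩
      have hu' : u = ⊤ := Ideal.isUnit_iff.mp hu
      subst hu'
      have h1 : (⟨(⊤ : Ideal R), mem_nonZeroDivisors_iff_ne_zero.mpr top_ne_bot⟩ : (Ideal R)⁰) = 1 :=
        Subtype.ext Ideal.one_eq_top.symm
      rw [h1, map_one, mul_one]
    · intro a v ha hv ih hva
      have hv0 : v ≠ ⊥ := hv.ne_zero
      obtain ⟨I', hI', hI'1, hI'S⟩ := ih ha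
      let v₀ : HeightOneSpectrum R := ⟨v, Ideal.isPrime_of_prime hv, hv0⟩
      obtain ⟨b, 𝔟, hb0, hvb, h𝔟S⟩ := ClassGroup.exists_mul_eq_span_and_forall_not_mem v₀ S
      have h𝔟0 : 𝔟 ≠ ⊥ := by
        rintro rfl
        rw [Ideal.mul_bot, eq_comm, Ideal.span_singleton_eq_bot] at hvb
        exact hb0 hvb
      refine ⟨I' * 𝔟, mul_ne_zero hI' h𝔟0, ?_, ?_⟩
      · -- `[I'𝔟][v a] = ([I'][a]) ([𝔟][v]) = 1`
        have hmulI : (⟨I' * 𝔟, mem_nonZeroDivisors_iff_ne_zero.mpr (mul_ne_zero hI' h𝔟0)⟩ : (Ideal R)⁰) =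
            ⟨I', mem_nonZeroDivisors_iff_ne_zero.mpr hI'⟩ * ⟨𝔟, mem_nonZeroDivisors_iff_ne_zero.mpr h𝔟0⟩ :=
          rfl
        have hmulJ : (⟨v * a, mem_nonZeroDivisors_iff_ne_zero.mpr hva⟩ : (Ideal R)⁰) =
            ⟨v, mem_nonZeroDivisors_iff_ne_zero.mpr hv0⟩ * ⟨a, mem_nonZeroDivisors_iff_ne_zero.mpr ha⟩ :=
          rfl
        have hvb1 : ClassGroup.mk0 ⟨𝔟, mem_nonZeroDivisors_iff_ne_zero.mpr h𝔟0⟩ *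
            ClassGroup.mk0 ⟨v, mem_nonZeroDivisors_iff_ne_zero.mpr hv0⟩ = 1 := by
          rw [← map_mul]
          have : (⟨𝔟, mem_nonZeroDivisors_iff_ne_zero.mpr h𝔟0⟩ * ⟨v, mem_nonZeroDivisors_iff_ne_zero.mpr hv0⟩ :
              (Ideal R)⁰) = ⟨Ideal.span {b}, mem_nonZeroDivisors_iff_ne_zero.mpr
                (by rw [Ne, Ideal.zero_eq_bot, Ideal.span_singleton_eq_bot]; exact hb0)⟩ := by
            apply Subtype.ext
            change 𝔟 * v = Ideal.span {b}
            rw [mul_comm]; exact hvb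
          rw [this, ClassGroup.mk0_eq_one_iff]
          exact ⟨⟨b, rfl⟩⟩
        rw [hmulI, hmulJ, map_mul, map_mul,
          mul_comm (ClassGroup.mk0 ⟨v, mem_nonZeroDivisors_iff_ne_zero.mpr hv0⟩), mul_mul_mul_comm,
          hI'1, hvb1, one_mul]
      · intro w hw hdvd
        rcases w.isPrime.mul_le.mp (Ideal.le_of_dvd hdvd) with h | h
        · exact hI'S w hw (Ideal.dvd_iff_le.mpr h)
        · exact h𝔟S w hw (Ideal.dvd_iff_le.mpr h)
  obtain ⟨I, hI, hI1, hIS⟩ := key J hJ0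
  refine ⟨I, hI, ?_, hIS⟩
  rw [hJc, mul_inv_eq_one] at hI1
  exact hI1

/-! ### §2. `ℚ(ζ_{p^{k+1}})`, `p` odd: conjugation is trivial modulo `λ = ζ − 1` -/

section Cyclotomic

variable (p k : ℕ) [hp : Fact p.Prime] (K : Type) [Field K] [NumberField K]
  [hcyc : IsCyclotomicExtension {p ^ (k + 1)} ℚ K]

include hcyc in
/-- `ℚ(ζ_{p^{k+1}})` is a CM field for `p` odd. [folklore] -/
private theorem isCMField_of_prime_pow (hodd : p ≠ 2) : IsCMField K := by
  refine IsCyclotomicExtension.Rat.isCMField K ⟨p ^ (k + 1), Set.mem_singleton _, ?_⟩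
  have hp3 : 3 ≤ p := by
    have := hp.1.two_le
    omega
  calc 2 < 3 := by norm_num
    _ ≤ p := hp3
    _ = p ^ 1 := (pow_one p).symm
    _ ≤ p ^ (k + 1) := Nat.pow_le_pow_right hp.1.pos (by omega)

omit hp in
/-- The complex conjugate of a unit, as an element of `𝓞 K`. [folklore] -/
private theorem coe_unitsComplexConj' [IsCMField K] (η : (𝓞 K)ˣ) :
    ((unitsComplexConj K η : (𝓞 K)ˣ) : 𝓞 K) = ringOfIntegersComplexConj K (η : 𝓞 K) := rfl

include hcyc in
/-- The unit `ζ` of `𝓞 K` attached to the chosen primitive root, and its membership in `torsion K`.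
[folklore] -/
private theorem zetaUnit_mem_torsion :
    (((IsCyclotomicExtension.zeta_spec (p ^ (k + 1)) ℚ K).toInteger_isPrimitiveRoot.isUnit
        (NeZero.ne _)).unit) ∈ torsion K := by
  rw [torsion, CommGroup.mem_torsion, isOfFinOrder_iff_pow_eq_one]
  refine ⟨p ^ (k + 1), pow_pos hp.1.pos _, ?_⟩
  ext
  rw [Units.val_pow_eq_pow_val, IsUnit.unit_spec,
    (IsCyclotomicExtension.zeta_spec (p ^ (k + 1)) ℚ K).toInteger_isPrimitiveRoot.pow_eq_one,
    Units.val_one]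

include hcyc in
/-- **Complex conjugation is trivial modulo `λ = ζ − 1`**: `x̄ − x ∈ (ζ − 1)` for every `x ∈ 𝓞 K`,
`K = ℚ(ζ_{p^{k+1}})`, `p` odd (the residue field `𝓞_K/(λ) = 𝔽_p` is generated by `1`, and
`λ̄ = −ζ⁻¹λ`). [cite: Washington1997, Thm. 4.14 (proof)] -/
theorem conj_sub_self_mem_span_toInteger_sub_one [IsCMField K] (hodd : p ≠ 2) (x : 𝓞 K) :
    ringOfIntegersComplexConj K x - x ∈
      Ideal.span {(IsCyclotomicExtension.zeta_spec (p ^ (k + 1)) ℚ K).toInteger - 1} := by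
  classical
  set hζ := IsCyclotomicExtension.zeta_spec (p ^ (k + 1)) ℚ K
  set lam : 𝓞 K := hζ.toInteger - 1 with hlam
  have hprime : Prime lam := hζ.zeta_sub_one_prime
  -- `λ̄ = t λ`
  have hconjlam : ∃ t : 𝓞 K, ringOfIntegersComplexConj K lam = t * lam := by
    set ζu := (hζ.toInteger_isPrimitiveRoot.isUnit (NeZero.ne _)).unit with hζu
    have hζu_tors : ζu ∈ torsion K := zetaUnit_mem_torsion p k K
    -- `ζ̄ = ζ⁻¹` in `𝓞 K`
    have hconjζ : ringOfIntegersComplexConj K (ζu : 𝓞 K) = ((ζu⁻¹ : (𝓞 K)ˣ) : 𝓞 K) := by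
      have h : unitsComplexConj K ζu = ζu⁻¹ := by
        simpa using unitsComplexConj_torsion K ⟨ζu, hζu_tors⟩
      rw [← coe_unitsComplexConj', h]
    have hlam' : lam = (ζu : 𝓞 K) - 1 := by rw [hlam, hζu, IsUnit.unit_spec]
    refine ⟨-((ζu⁻¹ : (𝓞 K)ˣ) : 𝓞 K), ?_⟩
    rw [hlam', map_sub, map_one, hconjζ]
    linear_combination (Units.inv_mul ζu)
  obtain ⟨t, ht⟩ := hconjlam
  -- the quotient `𝓞 K / (λ)` has `p` elements and is generated by `1`
  have hcard : Nat.card (𝓞 K ⧸ Ideal.span {lam}) = p := by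
    rw [hlam, hζ.card_quotient_toInteger_sub_one, hζ.norm_toInteger_sub_one_of_prime_ne_two hodd]
    simp
  have hne : (Ideal.span {lam} : Ideal (𝓞 K)) ≠ ⊤ := by
    rw [Ne, Ideal.span_singleton_eq_top]; exact hprime.not_unit
  have h1 : (1 : 𝓞 K ⧸ Ideal.span {lam}) ≠ 0 := by
    rw [Ne, ← map_one (Ideal.Quotient.mk (Ideal.span {lam})), Ideal.Quotient.eq_zero_iff_mem]
    exact (Ideal.ne_top_iff_one _).mp hne
  have htop := zmultiples_eq_top_of_prime_card hcard h1
  have hmemx : Ideal.Quotient.mk (Ideal.span {lam}) x ∈ AddSubgroup.zmultiples (1 : 𝓞 K ⧸ _) := by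
    rw [htop]; exact AddSubgroup.mem_top _
  obtain ⟨n, hn⟩ := AddSubgroup.mem_zmultiples_iff.mp hmemx
  -- `x ≡ n (mod λ)`
  have hxn : x - (n : 𝓞 K) ∈ Ideal.span {lam} := by
    rw [← Ideal.Quotient.eq, ← hn, zsmul_one, map_intCast]
  obtain ⟨s, hs⟩ := Ideal.mem_span_singleton'.mp hxn
  -- `x̄ − x = (x̄ − n) − (x − n)` and `conj (x − n) = s̄ λ̄ = s̄ t λ`
  have hconj : ringOfIntegersComplexConj K x - (n : 𝓞 K) ∈ Ideal.span {lam} := by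
    have : ringOfIntegersComplexConj K x - (n : 𝓞 K) = ringOfIntegersComplexConj K (x - (n : 𝓞 K)) := by
      rw [map_sub, map_intCast]
    rw [this, ← hs, map_mul, ht, ← mul_assoc]
    exact Ideal.mul_mem_left _ _ (Ideal.mem_span_singleton_self lam)
  have := Ideal.sub_mem _ hconj hxn
  rwa [sub_sub_sub_cancel_right] at this

/-! ### §3. Washington Thm. 4.14: `Cl(ℚ(ζ_{p^{k+1}})⁺) → Cl(ℚ(ζ_{p^{k+1}}))` is injective -/

include hcyc in
/-- **Washington Thm. 4.14 / Lang Thm. 4.2: for `K = ℚ(ζ_{p^{k+1}})`, `p` odd, the natural map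
`Cl(K⁺) → Cl(K)` is injective** — no ideal class of the maximal real subfield capitulates in `K`.
[cite: Washington1997, Thm. 4.14] [cite: Lang1990, Ch. 3 §4, Thm. 4.2] -/
theorem classGroupExtend_injective_of_isCyclotomicExtension_prime_pow (hodd : p ≠ 2) :
    Function.Injective (classGroupExtend (maximalRealSubfield K) K) := by
  classical
  haveI : IsCMField K := isCMField_of_prime_pow p k K hodd
  set hζ := IsCyclotomicExtension.zeta_spec (p ^ (k + 1)) ℚ K
  set lam : 𝓞 K := hζ.toInteger - 1 with hlam
  have hprime : Prime lam := hζ.zeta_sub_one_prime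
  have hlam0 : lam ≠ 0 := hprime.ne_zero
  -- the prime `(λ)` of `K` and the prime `(λ) ∩ K⁺` of `K⁺`
  let L₁ : HeightOneSpectrum (𝓞 K) :=
    ⟨Ideal.span {lam}, (Ideal.span_singleton_prime hlam0).mpr hprime, by
      rw [Ne, Ideal.span_singleton_eq_bot]; exact hlam0⟩
  let v : HeightOneSpectrum (𝓞 (maximalRealSubfield K)) := L₁.under (𝓞 (maximalRealSubfield K))
  rw [← MonoidHom.ker_eq_bot_iff, Subgroup.eq_bot_iff_forall]
  intro c hc
  -- a representative `𝔞` of `c` prime to `v`, with `𝔞𝓞_K = (α)`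
  obtain ⟨𝔞, h𝔞, rfl, h𝔞S⟩ := exists_mk0_eq_and_not_dvd {v} c
  rw [MonoidHom.mem_ker, classGroupExtend_mk0, ClassGroup.mk0_eq_one_iff] at hc
  obtain ⟨α, hα⟩ := hc
  have hα' : 𝔞.map (algebraMap (𝓞 (maximalRealSubfield K)) (𝓞 K)) = Ideal.span {α} := hα
  have hα0 : α ≠ 0 := by
    rintro rfl
    rw [Ideal.span_singleton_eq_bot.mpr rfl,
      Ideal.map_eq_bot_iff_of_injective (FaithfulSMul.algebraMap_injective _ _)] at hα'
    exact h𝔞 hα'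
  -- `λ ∤ α`
  have hndvd : ¬ lam ∣ α := by
    intro hdvd
    apply h𝔞S v (Finset.mem_singleton_self v)
    rw [Ideal.dvd_iff_le]
    have hle : Ideal.span {α} ≤ Ideal.span {lam} :=
      (Ideal.span_singleton_le_span_singleton).mpr hdvd
    rw [← hα', Ideal.map_le_iff_le_comap] at hle
    exact hle
  -- `ᾱ = α u`, `u` a root of unity, `u ≡ 1 (mod λ)`
  obtain ⟨u, hut, hu⟩ := exists_torsion_conj_generator K hα' hα0
  have hu1 : lam ∣ (u : 𝓞 K) - 1 := by
    have hmem := conj_sub_self_mem_span_toInteger_sub_one p k K hodd α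
    rw [hu, ← hlam, Ideal.mem_span_singleton] at hmem
    have : α * (u : 𝓞 K) - α = α * ((u : 𝓞 K) - 1) := by ring
    rw [this] at hmem
    exact (hprime.dvd_or_dvd hmem).resolve_left hndvd
  -- `u = ζ^r` or `u = -ζ^r`
  set ζ := IsCyclotomicExtension.zeta (p ^ (k + 1)) ℚ K with hζdef
  have hoddn : Odd (p ^ (k + 1)) := (hp.1.odd_of_ne_two hodd).pow
  have hfin : IsOfFinOrder (((u : 𝓞 K)) : K) := by
    have h : IsOfFinOrder u := by
      have h' := hut
      rw [torsion, CommGroup.mem_torsion] at h'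
      exact h'
    exact (((algebraMap (𝓞 K) K).toMonoidHom.comp (Units.coeHom (𝓞 K))).isOfFinOrder h)
  obtain ⟨r, -, hr⟩ := hζ.exists_pow_or_neg_mul_pow_of_isOfFinOrder hoddn hfin
  -- the unit `ζ ∈ 𝓞 K` and the torsion element it defines
  set ζu := (hζ.toInteger_isPrimitiveRoot.isUnit (NeZero.ne _)).unit with hζu
  have hζu_tors : ζu ∈ torsion K := zetaUnit_mem_torsion p k K
  have hζucoe : ((ζu : 𝓞 K) : K) = ζ := by simp [hζu, IsUnit.unit_spec]
  rcases hr with hr | hr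
  · -- `u = ζ^r = φ(ζ^m)` with `2m ≡ r (mod p^{k+1})`: then `𝔞` is principal
    obtain ⟨j, hj⟩ := hoddn
    set m : ℕ := r * (j + 1) with hm
    have h2m : m * 2 = p ^ (k + 1) * r + r := by rw [hm, hj]; ring
    have huζ : u = ζu ^ r := by
      apply Units.ext; apply RingOfIntegers.ext
      simp [hζucoe, hr]
    have hφ : unitsMulComplexConjInv K (ζu ^ m) = ⟨u, hut⟩ := by
      have htm : (ζu ^ m) ∈ torsion K := pow_mem hζu_tors m
      have h := unitsMulComplexConjInv_apply_torsion K ⟨ζu ^ m, htm⟩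
      -- `φ(ζ^m) = ζ^{2m} = ζ^r`
      apply Subtype.ext
      have h' := congrArg (fun t : torsion K => (t : (𝓞 K)ˣ)) h
      simp only at h'
      change unitsMulComplexConjInv K (ζu ^ m) = (⟨ζu ^ m, htm⟩ : torsion K) ^ 2 at h
      rw [h]
      change (ζu ^ m) ^ 2 = u
      have hζn : ζu ^ p ^ (k + 1) = 1 := by
        apply Units.ext; apply RingOfIntegers.ext
        simp [hζucoe, hζ.pow_eq_one]
      rw [huζ, ← pow_mul, h2m, pow_add, pow_mul, hζn, one_pow, one_mul]
    -- as in Washington Thm. 10.3: `γ = α ζ^m` is conjugation-fixed and generates `𝔞𝓞_K`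
    set η : (𝓞 K)ˣ := ζu ^ m
    have hη' : (u : 𝓞 K) * ringOfIntegersComplexConj K (η : 𝓞 K) = (η : 𝓞 K) := by
      have h := congrArg (fun t : torsion K => ((t : (𝓞 K)ˣ) : 𝓞 K)) hφ
      simp only [unitsMulComplexConjInv_apply] at h
      rw [← coe_unitsComplexConj', ← h, Units.val_mul, mul_assoc, ← Units.val_mul, inv_mul_cancel,
        Units.val_one, mul_one]
    have hfix : ringOfIntegersComplexConj K (α * (η : 𝓞 K)) = α * (η : 𝓞 K) := by
      rw [map_mul, hu, mul_assoc, hη']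
    have hspan : 𝔞.map (algebraMap (𝓞 (maximalRealSubfield K)) (𝓞 K)) =
        Ideal.span {α * (η : 𝓞 K)} := by
      rw [hα', Ideal.span_singleton_mul_right_unit η.isUnit]
    rw [ClassGroup.mk0_eq_one_iff]
    exact isPrincipal_of_map_eq_span_of_conj_eq K hspan hfix
  · -- `u = -ζ^r` is impossible: `λ ∣ u - 1` and `λ ∣ ζ^r - 1` give `λ ∣ 2`
    exfalso
    have huζ : (u : 𝓞 K) = -(hζ.toInteger) ^ r := by
      apply RingOfIntegers.ext
      simp [hr, hζdef]
    have h2 : lam ∣ hζ.toInteger ^ r - 1 := by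
      have := sub_dvd_pow_sub_pow hζ.toInteger 1 r
      rwa [one_pow] at this
    have h3 : lam ∣ 2 * hζ.toInteger ^ r := by
      have := dvd_sub h2 hu1
      rw [huζ] at this
      have e : hζ.toInteger ^ r - 1 - (-hζ.toInteger ^ r - 1) = 2 * hζ.toInteger ^ r := by ring
      rwa [e] at this
    have hunit : IsUnit (hζ.toInteger ^ r) :=
      (hζ.toInteger_isPrimitiveRoot.isUnit (NeZero.ne _)).pow r
    exact hζ.toInteger_sub_one_not_dvd_two hodd ((hunit.dvd_mul_right).mp h3)

include hcyc in
/-- With the surjectivity of the norm (`IsCMField.classGroupNorm_maximalRealSubfield_surjective`): for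
`K = ℚ(ζ_{p^{k+1}})`, `p` odd, **`N_{K/K⁺} c = 1 ↔ c̄ = c⁻¹`** — Lang's exact sequence
`1 → C_K⁻ → C_K → C_{K⁺} → 1` (Thm. 4.4) with `C_K⁻ = ker N`. [cite: Lang1990, Ch. 3 §4, Thm. 4.4] -/
theorem classGroupExtend_injective_and_norm_surjective (hodd : p ≠ 2) :
    Function.Injective (classGroupExtend (maximalRealSubfield K) K) ∧
      Function.Surjective (classGroupNorm (maximalRealSubfield K) K) := by
  haveI : IsCMField K := isCMField_of_prime_pow p k K hodd
  exact ⟨classGroupExtend_injective_of_isCyclotomicExtension_prime_pow p k K hodd,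
    IsCMField.classGroupNorm_maximalRealSubfield_surjective K⟩

end Cyclotomic

end Literature.NumberTheory.NumberFields

end
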